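import Summits.ResolutionOfSingularities.ResolutionOfSingularities.Theorems.WildConesCampaignW46ThreefoldsCharTwoSplittingRegime

/-!
# [OURS · L1 W4.6, rung (ii) at p = 2] RESOLUTION of threefold hypersurface double points in the
# hyperbolic-splitting regime: along EVERY branch the point-blow-up procedure reaches a smooth point within
# μ/2 blow-ups, through order-2-cleaned isolated double points only — over EVERY field of characteristic 2

Cell res-hironaka (LADDER-RESOLUTION rung L, D-0089), slot W4.6, seat res-L1-s46-pv-4 (gen 2); host route
`WildCones`, crux `ClassicalRegimes` (stmt-ResolutionOfSingularities-16884). Third of three files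
(`…CurveLeaf`, `…SplittingRegime`, this): the run-level consequences of the one-step closure
`threefold_regime_step` (previous file) and the exact drop `threefold_muDrop_eq` (p471960).

HONEST FRAMING. Everything here is OURS: theorems about route WildCones' own typed point-blow-up
dynamics (`Theorems/WildConesClassicalRegimesDefs.lean`; vocabulary recalled in the previous file). It
REPLACES THE ROLE of the resolution conclusion of Th. 16.13 (H. Hironaka, ms. 2017-03-23, p.87 l.26–30:
the procedure of Th. 16.6 applied «repeatedly but finitely many times» ends in a smooth transform) in ONE
regime — order-2-cleaned isolated double points `z² = a(u₀,u₁,u₂)` in characteristic `2`, where every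
centre rule must blow up the singular point — with OUR invariant, the Milnor number, and a NUMBER.
NOTHING here is a statement of the manuscript [Hironaka2017] and nothing of it is used; no FACT-LIST
premise. AI review is weaker than expert review.

* `threefold_splittingRun` — along a run from an order-2-cleaned isolated state, as long as the states
  are double points they are order-2-cleaned ISOLATED double points with `μ(state m) + 2m = μ(c₀)`.
* `threefold_two_mul_add_two_le_mu` — such a prefix `0, …, M` has `2M + 2 ≤ μ(c₀)`.
* `threefold_resolves_le_half` — THE HEADLINE: along EVERY chart/translation word the dynamics reaches
  MULTIPLICITY `< 2` at some stage `m ≤ μ(c₀)/2`, every earlier state an order-2-cleaned isolated double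
  point with `μ` falling by exactly `2`; `threefold_smooth_le_half` — and at that stage the cleaned
  transform has a LINEAR monomial: `z² + ℓ(u) + …` is SMOOTH at the visited point (the exit is by
  resolution, never through a non-isolated singular point and never into the zero state);
  `threefold_smooth_of_forcedSuccessor` — the same from the crux's own hypothesis shape (a forced double
  point with a forced successor). p467896/p471960 only said «some state of index `≤ μ/2` is not forced».

References: G.-M. Greuel, G. Pfister, J. Algebra 689 (2026) = arXiv:2507.17078, Thm 3.5 / Cor 3.7
[GreuelPfister2026] (through the tree); H. Hironaka, ms. 2017, Th. 16.13 p.87 — quoted for the ROLE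
replaced only, under adjudication, not cited as fact.
-/

noncomputable section

-- single-problem summit: the doubled namespace component `ResolutionOfSingularities` is forced
set_option linter.dupNamespace false

open scoped BigOperators Classical

open MvPowerSeries

open Literature.AlgebraicGeometry.Resolution

namespace Summit.ResolutionOfSingularities.ResolutionOfSingularities.Theorems

namespace CampaignW46.ThreefoldsCharTwo

open WildCones WildCones.MuDropCharTwoOrdP

variable {κ : Type} [Field κ]

/-! ## Runs: the regime is kept until the multiplicity drops, and it drops within `μ/2` blow-ups -/

/-- [OURS · L1 W4.6 rung (ii) at `p = 2`; NOT a statement of the manuscript] **Along a run the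
hyperbolic-splitting regime is kept as long as the multiplicity is**: over any field of characteristic
`2`, from an order-2-cleaned isolated state `c₀` of `z² = a(u₀,u₁,u₂)`, along any chart word `i` and
translation word `t`, if the states `0, …, M` are all double points then they are all order-2-cleaned
ISOLATED double points and `μ(state m) + 2m = μ(c₀)` for `m ≤ M`. [folklore] -/
theorem threefold_splittingRun [CharP κ 2] (c₀ : (Fin 3 → ℕ) → κ) (i : ℕ → Fin 3)
    (t : ℕ → Fin 3 → κ) (hO₀ : OrdP 2 3 κ c₀) (hI₀ : Isol 2 3 κ c₀) {M : ℕ}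
    (hrun : ∀ m ≤ M, MultP 2 3 κ (run 2 3 κ c₀ i t m)) :
    ∀ m ≤ M, OrdP 2 3 κ (run 2 3 κ c₀ i t m) ∧ Isol 2 3 κ (run 2 3 κ c₀ i t m) ∧
      mu 2 3 κ (run 2 3 κ c₀ i t m) + 2 * m = mu 2 3 κ c₀ := by
  intro m
  induction m with
  | zero => intro _; exact ⟨hO₀, hI₀, by simp [run]⟩
  | succ m ih =>
    intro hm
    obtain ⟨hO, hI, hμ⟩ := ih (by omega)
    have hM := hrun m (by omega)
    have hM' : MultP 2 3 κ (step 2 3 κ (i m) (t m) (run 2 3 κ c₀ i t m)) := hrun (m + 1) hm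
    obtain ⟨hO', hI', hμ'⟩ := threefold_regime_step _ (i m) (t m) hM hO hI hM'
    refine ⟨hO', hI', ?_⟩
    change mu 2 3 κ (step 2 3 κ (i m) (t m) (run 2 3 κ c₀ i t m)) + 2 * (m + 1) = mu 2 3 κ c₀
    omega

/-- [OURS · L1 W4.6 rung (ii) at `p = 2`; NOT a statement of the manuscript] **A prefix of double points
from an order-2-cleaned isolated double point has length `≤ μ(c₀)/2`**: if the states `0, …, M` are all
double points then `2M + 2 ≤ μ(c₀)` (the start's own multiplicity is part of the hypothesis on the
prefix). [folklore] -/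
theorem threefold_two_mul_add_two_le_mu [CharP κ 2] (c₀ : (Fin 3 → ℕ) → κ) (i : ℕ → Fin 3)
    (t : ℕ → Fin 3 → κ) (hO₀ : OrdP 2 3 κ c₀) (hI₀ : Isol 2 3 κ c₀) {M : ℕ}
    (hrun : ∀ m ≤ M, MultP 2 3 κ (run 2 3 κ c₀ i t m)) : 2 * M + 2 ≤ mu 2 3 κ c₀ := by
  obtain ⟨hO, hI, hμ⟩ := threefold_splittingRun c₀ i t hO₀ hI₀ hrun M le_rfl
  have h2 := threefold_two_le_mu (hrun M le_rfl) hO hI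
  omega

/-- [OURS · L1 W4.6 rung (ii) at `p = 2`, THE HEADLINE — replaces the ROLE of the resolution conclusion
of Th. 16.13 p.87 l.26–30 in the hyperbolic-splitting regime; NOT a statement of the manuscript]
**RESOLUTION WITHIN `μ/2` POINT BLOW-UPS, along every branch, over EVERY field of characteristic two.**
From an order-2-cleaned isolated double point `c₀` of the threefold hypersurface `z² = a(u₀,u₁,u₂)`,
along ANY chart word `i` and translation word `t`, the point-blow-up dynamics reaches a state of
MULTIPLICITY `< 2` (`¬ MultP`: the cleaned transform has a monomial of degree `≤ 1` at the visited point —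
the double point is RESOLVED there) at some stage `m ≤ μ(c₀)/2`, and every earlier state is an
order-2-cleaned isolated double point with `μ(state k) = μ(c₀) − 2k`. In this regime the forced
procedure (blow up the singular point) is not merely finite: it never meets a non-isolated singular
point and ends by resolving. [cite: GreuelPfister2026, Thm 3.5 and Cor 3.7] -/
theorem threefold_resolves_le_half [CharP κ 2] (c₀ : (Fin 3 → ℕ) → κ) (i : ℕ → Fin 3)
    (t : ℕ → Fin 3 → κ) (hO₀ : OrdP 2 3 κ c₀) (hI₀ : Isol 2 3 κ c₀) :
    ∃ m ≤ mu 2 3 κ c₀ / 2, ¬ MultP 2 3 κ (run 2 3 κ c₀ i t m) ∧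
      ∀ k < m, MultP 2 3 κ (run 2 3 κ c₀ i t k) ∧ OrdP 2 3 κ (run 2 3 κ c₀ i t k) ∧
        Isol 2 3 κ (run 2 3 κ c₀ i t k) ∧ mu 2 3 κ (run 2 3 κ c₀ i t k) + 2 * k = mu 2 3 κ c₀ := by
  -- some state of index `≤ μ/2` is not a double point
  have hex : ∃ m, ¬ MultP 2 3 κ (run 2 3 κ c₀ i t m) := by
    by_contra h
    push Not at h
    have := threefold_two_mul_add_two_le_mu c₀ i t hO₀ hI₀ (M := mu 2 3 κ c₀) fun m _ => h m
    omega
  -- take the first one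
  let m := Nat.find hex
  have hm : ¬ MultP 2 3 κ (run 2 3 κ c₀ i t m) := Nat.find_spec hex
  have hbefore : ∀ k < m, MultP 2 3 κ (run 2 3 κ c₀ i t k) := fun k hk => by
    have := Nat.find_min hex hk
    push Not at this
    exact this
  refine ⟨m, ?_, hm, fun k hk => ?_⟩
  · rcases Nat.eq_zero_or_pos m with h0 | hpos
    · rw [h0]; exact Nat.zero_le _
    · have hle := threefold_two_mul_add_two_le_mu c₀ i t hO₀ hI₀ (M := m - 1)
        fun k hk => hbefore k (by omega)
      omega
  · have hpre : ∀ k' ≤ k, MultP 2 3 κ (run 2 3 κ c₀ i t k') := fun k' hk' => hbefore k' (by omega)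
    obtain ⟨hO, hI, hμ⟩ := threefold_splittingRun c₀ i t hO₀ hI₀ hpre k le_rfl
    exact ⟨hbefore k hk, hO, hI, hμ⟩

/-- [OURS · L1 W4.6 rung (ii) at `p = 2`, THE HEADLINE in smooth-point form; NOT a statement of the
manuscript] **The procedure ends at a SMOOTH point**: from an order-2-cleaned isolated double point `c₀`
of `z² = a(u₀,u₁,u₂)` over any field of characteristic `2`, along every chart/translation word, at some
stage `m ≤ μ(c₀)/2` the cleaned transform has a LINEAR monomial (`z² + ℓ(u) + …`, smooth at the visited
point), all earlier states being order-2-cleaned isolated double points with `μ(state k) = μ(c₀) − 2k`.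
(`threefold_resolves_le_half` + the exit state is non-zero: `ser_ne_zero_of_isol` at `m = 0`,
`ser_step_ne_zero_of_ordP` after a step.) [cite: GreuelPfister2026, Thm 3.5 and Cor 3.7] -/
theorem threefold_smooth_le_half [CharP κ 2] (c₀ : (Fin 3 → ℕ) → κ) (i : ℕ → Fin 3)
    (t : ℕ → Fin 3 → κ) (hO₀ : OrdP 2 3 κ c₀) (hI₀ : Isol 2 3 κ c₀) :
    ∃ m ≤ mu 2 3 κ c₀ / 2,
      (∃ A, clean 2 3 κ (run 2 3 κ c₀ i t m) A ≠ 0 ∧ Finset.sum Finset.univ (fun j => A j) = 1) ∧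
      ∀ k < m, MultP 2 3 κ (run 2 3 κ c₀ i t k) ∧ OrdP 2 3 κ (run 2 3 κ c₀ i t k) ∧
        Isol 2 3 κ (run 2 3 κ c₀ i t k) ∧ mu 2 3 κ (run 2 3 κ c₀ i t k) + 2 * k = mu 2 3 κ c₀ := by
  obtain ⟨m, hm, hnot, hpre⟩ := threefold_resolves_le_half c₀ i t hO₀ hI₀
  refine ⟨m, hm, exists_linear_of_not_multP ?_ hnot, hpre⟩
  cases m with
  | zero => exact ser_ne_zero_of_isol (by norm_num) hI₀
  | succ k =>
    obtain ⟨hMk, hOk, -, -⟩ := hpre k (Nat.lt_succ_self k)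
    exact ser_step_ne_zero_of_ordP _ (i k) (t k) hMk hOk

/-- [OURS · L1 W4.6 rung (ii) at `p = 2`; NOT a statement of the manuscript] **From a FORCED double point
with a forced successor** (the crux's own hypothesis shape, no `OrdP` named): over any field of
characteristic `2`, if `c₀` and its first successor along the word are isolated double points then along
that word the dynamics reaches a smooth point (a linear cleaned monomial) within `μ(c₀)/2` blow-ups,
through order-2-cleaned isolated double points only (the regime lemma
`threefold_ordP_of_forcedSuccessor` supplies `OrdP c₀`). [folklore] -/
theorem threefold_smooth_of_forcedSuccessor [CharP κ 2] (c₀ : (Fin 3 → ℕ) → κ) (i : ℕ → Fin 3)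
    (t : ℕ → Fin 3 → κ) (hM₀ : MultP 2 3 κ c₀) (hI₀ : Isol 2 3 κ c₀)
    (hI₁ : Isol 2 3 κ (run 2 3 κ c₀ i t 1)) (hM₁ : MultP 2 3 κ (run 2 3 κ c₀ i t 1)) :
    ∃ m ≤ mu 2 3 κ c₀ / 2,
      (∃ A, clean 2 3 κ (run 2 3 κ c₀ i t m) A ≠ 0 ∧ Finset.sum Finset.univ (fun j => A j) = 1) ∧
      ∀ k < m, MultP 2 3 κ (run 2 3 κ c₀ i t k) ∧ OrdP 2 3 κ (run 2 3 κ c₀ i t k) ∧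
        Isol 2 3 κ (run 2 3 κ c₀ i t k) ∧ mu 2 3 κ (run 2 3 κ c₀ i t k) + 2 * k = mu 2 3 κ c₀ :=
  threefold_smooth_le_half c₀ i t (threefold_ordP_of_forcedSuccessor c₀ (i 0) (t 0) hM₀ hI₁ hM₁) hI₀

end CampaignW46.ThreefoldsCharTwo

end Summit.ResolutionOfSingularities.ResolutionOfSingularities.Theorems

end
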